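import Literature.Analysis.Asymptotics.ExpTailConvolution
import Mathlib.MeasureTheory.Constructions.Pi
import HarnessLib

/-!
# Power-log asymptotics of weighted sublevel volumes of a monomial (logarithmic coordinates)

The elementary ("monomial", "normal crossing") case of the asymptotic theory of Laplace
integrals / sublevel volumes with real-analytic phase: Arnold–Gusein-Zade–Varchenko II §7.2
(Theorem 7.1 with Lemmas 7.3–7.5: the Gelfand–Leray function of a monomial phase with a monomial
weight expands in powers and logarithms, proved "by induction on `n`") and Lin 2017,
Proposition 2.1 (the real log-canonical threshold of `ω^κ` with respect to the weight `ω^τ` over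
the positive orthant is `λ = min_j (τ_j + 1)/κ_j` with multiplicity `θ =` the number of indices
attaining the minimum).

We work in logarithmic coordinates `x_j = e^{-y_j}`, `y_j > 0`, where the weight
`x_j^{w_j - 1} dx_j` on `(0,1]` becomes `e^{-w_j y_j} dy_j` on `(0,∞)` (`expMeasure (w j)`), the
sublevel set `{∏ x_j^{κ_j} ≤ t}` becomes the half-space `{∑ κ_j y_j ≥ s}`, `s = log 1/t`, and the
scale `t^λ (log 1/t)^{θ-1}` becomes `e^{-λ s} s^{θ-1}`.  The weighted volume of the half-space is
the **tail profile** `tailProfile κ w s`; it satisfies the one-variable recursion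
(`tailProfile_succ`)

  `tailProfile κ w s = ∫_{y>0} e^{-w₀ y} · tailProfile κ' w' (s - κ₀ y) dy`

(`κ', w'` the remaining exponents), i.e. the exponential convolution of
`Literature/Analysis/Asymptotics/ExpTailConvolution.lean`, whose three cases give, by induction
on the number of variables (`tendsto_tailProfile`):

  `tailProfile κ w s · e^{λ s} / s^{θ-1} → C > 0`  (`s → ∞`),  `λ = rlct κ w`, `θ = rlctMult κ w`,

for every `κ ≠ 0` and all weights `w_j > 0`.  The cube form and the Laplace-integral form are
derived in `MonomialSublevelAsymptotics.lean`.

## References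

* V. I. Arnold, S. M. Gusein-Zade, A. N. Varchenko, *Singularities of Differentiable Maps II*
  (2012), Part II §7.2, Thm. 7.1, Lemmas 7.3–7.5, Thm. 7.3. [ArnoldGuseinzadeVarchenko2012]
* S. Lin, *Algebraic methods for evaluating integrals in Bayesian statistics*, arXiv:1003.5338,
  Prop. 2.1. [Lin2017]
-/

noncomputable section

open MeasureTheory Filter Set Topology

open scoped ENNReal

namespace Literature.Analysis.Asymptotics.MonomialPhase

/-! ## The one-dimensional weight `e^{-ω y} dy` on `(0, ∞)` -/

/-- The finite measure `e^{-ω y} dy` on `(0,∞)` (the weight `x^{ω-1} dx` on `(0,1]` in the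
logarithmic coordinate `x = e^{-y}`). [folklore] -/
def expMeasure (ω : ℝ) : Measure ℝ :=
  (volume.restrict (Ioi (0 : ℝ))).withDensity fun y => ENNReal.ofReal (Real.exp (-(ω * y)))

/-- Unfolding lemma for `expMeasure`. [folklore] -/
theorem expMeasure_def (ω : ℝ) : expMeasure ω =
    (volume.restrict (Ioi (0 : ℝ))).withDensity fun y => ENNReal.ofReal (Real.exp (-(ω * y))) :=
  rfl

/-- `expMeasure ω s = ∫_{s ∩ (0,∞)} e^{-ωy} dy`. [folklore] -/
theorem expMeasure_apply (ω : ℝ) {s : Set ℝ} (hs : MeasurableSet s) :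
    expMeasure ω s = ∫⁻ y in s ∩ Ioi 0, ENNReal.ofReal (Real.exp (-(ω * y))) := by
  rw [expMeasure, withDensity_apply _ hs, Measure.restrict_restrict hs]

/-- `e^{-ωy}` is integrable on `(0,∞)` for `ω > 0`. [folklore] -/
theorem integrableOn_exp_neg {ω : ℝ} (hω : 0 < ω) :
    IntegrableOn (fun y => Real.exp (-(ω * y))) (Ioi (0 : ℝ)) := by
  simpa only [one_mul] using ExpTail.integrableOn_const_mul_exp_neg hω 1

/-- Total mass `expMeasure ω ℝ = 1/ω`. [folklore] -/
theorem expMeasure_univ {ω : ℝ} (hω : 0 < ω) : expMeasure ω univ = ENNReal.ofReal (1 / ω) := by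
  rw [expMeasure_apply ω MeasurableSet.univ, univ_inter,
    ← ofReal_integral_eq_lintegral_ofReal (integrableOn_exp_neg hω)
      (ae_of_all _ fun y => (Real.exp_pos _).le),
    ExpTail.integral_exp_neg_mul_Ioi hω]

/-- `expMeasure ω` is a finite measure for `ω > 0`. [folklore] -/
theorem isFiniteMeasure_expMeasure {ω : ℝ} (hω : 0 < ω) : IsFiniteMeasure (expMeasure ω) :=
  ⟨by rw [expMeasure_univ hω]; exact ENNReal.ofReal_lt_top⟩

/-- `expMeasure ω` lives on `(0,∞)`. [folklore] -/
theorem expMeasure_restrict_Ioi (ω : ℝ) : (expMeasure ω).restrict (Ioi 0) = expMeasure ω := by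
  rw [expMeasure, restrict_withDensity measurableSet_Ioi, Measure.restrict_restrict measurableSet_Ioi,
    inter_self]

/-! ## The tail profile -/

variable {d : ℕ}

/-- The half-space `{y | s ≤ ∑ κ_j y_j}` is measurable. [folklore] -/
theorem measurableSet_tailSet (κ : Fin d → ℕ) (s : ℝ) :
    MeasurableSet {y : Fin d → ℝ | s ≤ ∑ j, (κ j : ℝ) * y j} :=
  measurableSet_le measurable_const (by fun_prop)

/-- **Tail profile** of the monomial `x^κ` with weights `w`: the `∏_j e^{-w_j y_j} dy_j`-volume of
the half-space `{y ∈ (0,∞)^d | ∑_j κ_j y_j ≥ s}`, i.e. (in the coordinates `x_j = e^{-y_j}`) the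
`∏ x_j^{w_j-1} dx_j`-volume of the sublevel set `{x ∈ (0,1]^d | ∏ x_j^{κ_j} ≤ e^{-s}}` — the
Gelfand–Leray / state-density primitive of AGV II §7.2 and Lin 2017 §2.
[cite: ArnoldGuseinzadeVarchenko2012, Part II §7.2] -/
def tailProfile (κ : Fin d → ℕ) (w : Fin d → ℝ) (s : ℝ) : ℝ :=
  ((Measure.pi fun j => expMeasure (w j)) {y : Fin d → ℝ | s ≤ ∑ j, (κ j : ℝ) * y j}).toReal

/-- Unfolding lemma for `tailProfile`. [folklore] -/
theorem tailProfile_def (κ : Fin d → ℕ) (w : Fin d → ℝ) (s : ℝ) : tailProfile κ w s =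
    ((Measure.pi fun j => expMeasure (w j)) {y : Fin d → ℝ | s ≤ ∑ j, (κ j : ℝ) * y j}).toReal :=
  rfl

section Basic

variable (κ : Fin d → ℕ) {w : Fin d → ℝ} (hw : ∀ j, 0 < w j)
include hw

/-- The factors of the product weight are σ-finite (indeed finite). [folklore] -/
theorem sigmaFinite_expMeasure : ∀ j, SigmaFinite (expMeasure (w j)) := fun j =>
  @IsFiniteMeasure.toSigmaFinite _ _ _ (isFiniteMeasure_expMeasure (hw j))

/-- Total mass of the product weight: `∏_j 1/w_j`. [folklore] -/
theorem pi_expMeasure_univ :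
    (Measure.pi fun j => expMeasure (w j)) univ = ENNReal.ofReal (∏ j, 1 / w j) := by
  haveI := sigmaFinite_expMeasure hw
  rw [Measure.pi_univ]
  simp_rw [expMeasure_univ (hw _)]
  rw [ENNReal.ofReal_prod_of_nonneg fun j _ => (one_div_pos.2 (hw j)).le]

/-- The product weight lives on the open orthant. [folklore] -/
theorem pi_expMeasure_eq_restrict :
    (Measure.pi fun j => expMeasure (w j)) =
      (Measure.pi fun j => expMeasure (w j)).restrict (Set.pi univ fun _ => Ioi (0 : ℝ)) := by
  haveI := sigmaFinite_expMeasure hw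
  rw [Measure.restrict_pi_pi]
  simp_rw [expMeasure_restrict_Ioi]

/-- Measures of sets may be computed inside the open orthant. [folklore] -/
theorem pi_expMeasure_apply_eq_inter (A : Set (Fin d → ℝ)) (hA : MeasurableSet A) :
    (Measure.pi fun j => expMeasure (w j)) A =
      (Measure.pi fun j => expMeasure (w j)) (A ∩ Set.pi univ fun _ => Ioi (0 : ℝ)) := by
  conv_lhs => rw [pi_expMeasure_eq_restrict hw, Measure.restrict_apply hA]

/-- The tail profile is finite: `≤ ∏ 1/w_j`. [folklore] -/
theorem measure_tailSet_le (s : ℝ) :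
    (Measure.pi fun j => expMeasure (w j)) {y : Fin d → ℝ | s ≤ ∑ j, (κ j : ℝ) * y j} ≤
      ENNReal.ofReal (∏ j, 1 / w j) := by
  rw [← pi_expMeasure_univ hw]
  exact measure_mono (subset_univ _)

/-- The half-space has finite weighted volume. [folklore] -/
theorem measure_tailSet_ne_top (s : ℝ) :
    (Measure.pi fun j => expMeasure (w j)) {y : Fin d → ℝ | s ≤ ∑ j, (κ j : ℝ) * y j} ≠ ⊤ :=
  ne_top_of_le_ne_top ENNReal.ofReal_ne_top (measure_tailSet_le κ hw s)

omit hw in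
/-- `0 ≤ tailProfile`. [folklore] -/
theorem tailProfile_nonneg (s : ℝ) : 0 ≤ tailProfile κ w s := ENNReal.toReal_nonneg

/-- `tailProfile κ w s ≤ ∏ 1/w_j`. [folklore] -/
theorem tailProfile_le (s : ℝ) : tailProfile κ w s ≤ ∏ j, 1 / w j :=
  ENNReal.toReal_le_of_le_ofReal (Finset.prod_nonneg fun j _ => (one_div_pos.2 (hw j)).le)
    (measure_tailSet_le κ hw s)

/-- The tail profile is antitone in `s`. [folklore] -/
theorem tailProfile_antitone : Antitone (tailProfile κ w) := fun s₁ _ h =>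
  ENNReal.toReal_mono (measure_tailSet_ne_top κ hw s₁)
    (measure_mono fun _ hy => h.trans hy)

/-- For `s ≤ 0` the half-space contains the whole orthant: `tailProfile κ w s = ∏ 1/w_j`.
[folklore] -/
theorem tailProfile_of_nonpos {s : ℝ} (hs : s ≤ 0) : tailProfile κ w s = ∏ j, 1 / w j := by
  rw [tailProfile, pi_expMeasure_apply_eq_inter hw _ (measurableSet_tailSet κ s)]
  have h : {y : Fin d → ℝ | s ≤ ∑ j, (κ j : ℝ) * y j} ∩ (Set.pi univ fun _ => Ioi (0 : ℝ)) =
      univ ∩ Set.pi univ fun _ => Ioi (0 : ℝ) := by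
    rw [univ_inter]
    refine inter_eq_right.2 fun y hy => hs.trans (Finset.sum_nonneg fun j _ => ?_)
    exact mul_nonneg (Nat.cast_nonneg _) (le_of_lt (hy j (mem_univ j)))
  rw [h, ← pi_expMeasure_apply_eq_inter hw _ MeasurableSet.univ, pi_expMeasure_univ hw,
    ENNReal.toReal_ofReal (Finset.prod_nonneg fun j _ => (one_div_pos.2 (hw j)).le)]

/-- With all exponents zero the profile is a step: `∏ 1/w_j` for `s ≤ 0`, `0` for `s > 0`.
[folklore] -/
theorem tailProfile_of_eq_zero (hκ : κ = 0) (s : ℝ) :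
    tailProfile κ w s = if s ≤ 0 then ∏ j, 1 / w j else 0 := by
  split_ifs with hs
  · exact tailProfile_of_nonpos κ hw hs
  · rw [tailProfile]
    have h : {y : Fin d → ℝ | s ≤ ∑ j, (κ j : ℝ) * y j} = ∅ := by
      ext y
      simp only [hκ, Pi.zero_apply, CharP.cast_eq_zero, zero_mul, Finset.sum_const_zero,
        mem_setOf_eq, mem_empty_iff_false, iff_false]
      exact hs
    rw [h, measure_empty, ENNReal.toReal_zero]

end Basic

/-! ## The one-variable recursion -/

section Recursion

variable (κ : Fin (d + 1) → ℕ) {w : Fin (d + 1) → ℝ} (hw : ∀ j, 0 < w j)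
include hw

/-- Peeling off the first variable (Tonelli): the half-space volume in `d+1` variables is the
`e^{-w₀ a} da`-integral of the half-space volumes in the remaining `d` variables at the shifted
levels `s - κ₀ a`. [folklore] -/
theorem measure_tailSet_succ (s : ℝ) :
    (Measure.pi fun j => expMeasure (w j)) {y : Fin (d + 1) → ℝ | s ≤ ∑ j, (κ j : ℝ) * y j} =
      ∫⁻ a in Ioi (0 : ℝ), ENNReal.ofReal (Real.exp (-(w 0 * a))) *
        (Measure.pi fun i : Fin d => expMeasure (w i.succ))
          {y : Fin d → ℝ | s - κ 0 * a ≤ ∑ i, (κ i.succ : ℝ) * y i} := by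
  haveI := sigmaFinite_expMeasure hw
  have hmp := (measurePreserving_piFinSuccAbove (fun j => expMeasure (w j)) 0).symm
  set B : Set (ℝ × (Fin d → ℝ)) := {p | s ≤ κ 0 * p.1 + ∑ i, (κ i.succ : ℝ) * p.2 i} with hB
  have hBm : MeasurableSet B := measurableSet_le measurable_const (by fun_prop)
  have hpre : (MeasurableEquiv.piFinSuccAbove (fun _ : Fin (d + 1) => ℝ) 0).symm ⁻¹'
      {y : Fin (d + 1) → ℝ | s ≤ ∑ j, (κ j : ℝ) * y j} = B := by
    ext p
    simp only [mem_preimage, mem_setOf_eq, MeasurableEquiv.piFinSuccAbove_symm_apply,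
      Fin.insertNthEquiv_zero, Fin.consEquiv_apply, Fin.sum_univ_succ, Fin.cons_zero,
      Fin.cons_succ, hB]
  rw [← hmp.measure_preimage (measurableSet_tailSet κ s).nullMeasurableSet, hpre,
    Measure.prod_apply hBm, expMeasure, lintegral_withDensity_eq_lintegral_mul _
      (by fun_prop) (measurable_measure_prodMk_left hBm)]
  refine setLIntegral_congr_fun measurableSet_Ioi fun a _ => ?_
  simp only [Pi.mul_apply]
  congr 2
  ext y
  simp only [hB, mem_preimage, mem_setOf_eq, sub_le_iff_le_add']

/-- **The recursion** `tailProfile κ w s = ∫_{a>0} e^{-w₀ a} tailProfile κ' w' (s - κ₀ a) da`.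
[cite: ArnoldGuseinzadeVarchenko2012, Part II §7.2 (proof of Thm. 7.1 by induction on `n`)] -/
theorem tailProfile_succ (s : ℝ) :
    tailProfile κ w s = ∫ a in Ioi (0 : ℝ), Real.exp (-(w 0 * a)) *
      tailProfile (fun i : Fin d => κ i.succ) (fun i => w i.succ) (s - κ 0 * a) := by
  have hw' : ∀ i : Fin d, 0 < w i.succ := fun i => hw _
  have hlin : Antitone fun a : ℝ => s - κ 0 * a := fun a b hab => by
    dsimp only
    nlinarith [Nat.cast_nonneg (α := ℝ) (κ 0)]
  have hmeas : Measurable fun a : ℝ =>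
      tailProfile (fun i : Fin d => κ i.succ) (fun i => w i.succ) (s - κ 0 * a) :=
    ((tailProfile_antitone (fun i : Fin d => κ i.succ) hw').comp hlin).measurable
  rw [tailProfile_def κ w s, measure_tailSet_succ κ hw s, integral_eq_lintegral_of_nonneg_ae]
  · congr 1
    refine setLIntegral_congr_fun measurableSet_Ioi fun a _ => ?_
    rw [ENNReal.ofReal_mul (Real.exp_pos _).le, tailProfile_def,
      ENNReal.ofReal_toReal (measure_tailSet_ne_top _ hw' _)]
  · exact ae_of_all _ fun a => mul_nonneg (Real.exp_pos _).le (tailProfile_nonneg _ _)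
  · exact ((Real.measurable_exp.comp (by fun_prop)).mul hmeas).aestronglyMeasurable

end Recursion

/-! ## The real log-canonical threshold of a monomial and its multiplicity -/

section RLCT

variable (κ : Fin d → ℕ) (w : Fin d → ℝ)

/-- **Real log-canonical threshold** of the monomial `x^κ` with respect to the weight
`∏ x_j^{w_j-1} dx_j`: `rlct κ w = min {w_j / κ_j : κ_j ≠ 0}` (Lin 2017, Prop. 2.1, with
`w_j = τ_j + 1`); set to `0` for the constant monomial `κ = 0`. [cite: Lin2017, Prop. 2.1] -/
def rlct : ℝ :=
  if h : (Finset.univ.filter fun j => κ j ≠ 0).Nonempty then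
    (Finset.univ.filter fun j => κ j ≠ 0).inf' h fun j => w j / κ j
  else 0

/-- **Multiplicity** of the real log-canonical threshold of `x^κ`: the number of indices `j` with
`κ_j ≠ 0` and `w_j / κ_j = rlct κ w` (Lin 2017, Prop. 2.1: `θ`). [cite: Lin2017, Prop. 2.1] -/
def rlctMult : ℕ :=
  (Finset.univ.filter fun j => κ j ≠ 0 ∧ w j / κ j = rlct κ w).card

variable {κ w}

/-- Some exponent is nonzero iff `κ ≠ 0`. [folklore] -/
theorem filter_ne_zero_nonempty_iff : (Finset.univ.filter fun j => κ j ≠ 0).Nonempty ↔ κ ≠ 0 := by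
  rw [Finset.filter_nonempty_iff, Ne, funext_iff]
  simp

/-- `rlct κ w ≤ w_j / κ_j` whenever `κ_j ≠ 0`. [folklore] -/
theorem rlct_le {j : Fin d} (hj : κ j ≠ 0) : rlct κ w ≤ w j / κ j := by
  have hne : (Finset.univ.filter fun j => κ j ≠ 0).Nonempty := ⟨j, by simpa using hj⟩
  rw [rlct, dif_pos hne]
  exact Finset.inf'_le _ (by simpa using hj)

/-- The minimum is attained. [folklore] -/
theorem exists_rlct_eq (hκ : κ ≠ 0) : ∃ j, κ j ≠ 0 ∧ rlct κ w = w j / κ j := by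
  have hne : (Finset.univ.filter fun j => κ j ≠ 0).Nonempty := filter_ne_zero_nonempty_iff.2 hκ
  obtain ⟨j, hj, hjeq⟩ := Finset.exists_mem_eq_inf' hne fun j => w j / κ j
  refine ⟨j, by simpa using hj, ?_⟩
  rw [rlct, dif_pos hne, hjeq]

/-- Characterisation of `rlct` as the attained lower bound. [folklore] -/
theorem rlct_eq_of (hκ : κ ≠ 0) {c : ℝ} (hle : ∀ j, κ j ≠ 0 → c ≤ w j / κ j)
    (hex : ∃ j, κ j ≠ 0 ∧ c = w j / κ j) : rlct κ w = c := by
  refine le_antisymm ?_ ?_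
  · obtain ⟨j, hj, rfl⟩ := hex
    exact rlct_le hj
  · obtain ⟨j, hj, hjeq⟩ := exists_rlct_eq (w := w) hκ
    rw [hjeq]
    exact hle j hj

/-- Convention `rlct 0 w = 0`. [folklore] -/
theorem rlct_of_eq_zero (hκ : κ = 0) : rlct κ w = 0 := by
  rw [rlct, dif_neg]
  rw [filter_ne_zero_nonempty_iff]
  exact fun h => h hκ

/-- `rlct κ w > 0` for `κ ≠ 0` and positive weights. [folklore] -/
theorem rlct_pos (hκ : κ ≠ 0) (hw : ∀ j, 0 < w j) : 0 < rlct κ w := by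
  obtain ⟨j, hj, hjeq⟩ := exists_rlct_eq (w := w) hκ
  rw [hjeq]
  exact div_pos (hw j) (by exact_mod_cast Nat.pos_of_ne_zero hj)

/-- The multiplicity as a sum of indicators. [folklore] -/
theorem rlctMult_eq_sum :
    rlctMult κ w = ∑ j, if κ j ≠ 0 ∧ w j / κ j = rlct κ w then 1 else 0 := by
  rw [rlctMult, Finset.card_filter]

/-- `rlctMult κ w ≥ 1` for `κ ≠ 0`. [folklore] -/
theorem rlctMult_pos (hκ : κ ≠ 0) : 0 < rlctMult κ w := by
  obtain ⟨j, hj, hjeq⟩ := exists_rlct_eq (w := w) hκ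
  rw [rlctMult, Finset.card_pos]
  exact ⟨j, by simpa using ⟨hj, hjeq.symm⟩⟩

/-- Convention `rlctMult 0 w = 0`. [folklore] -/
theorem rlctMult_of_eq_zero (hκ : κ = 0) : rlctMult κ w = 0 := by
  rw [rlctMult, Finset.card_eq_zero, Finset.filter_eq_empty_iff]
  intro j _ h
  exact h.1 (by simp [hκ])

end RLCT

/-! ## Adding a variable: the threshold and multiplicity of `Fin.cons` data -/

section Cons

variable (κ : Fin (d + 1) → ℕ) (w : Fin (d + 1) → ℝ)

/-- `κ = 0` iff its head and tail vanish. [folklore] -/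
theorem eq_zero_of_head_tail (hk : κ 0 = 0) (hκ' : (fun i : Fin d => κ i.succ) = 0) : κ = 0 := by
  funext j
  refine Fin.cases ?_ (fun i => ?_) j
  · exact hk
  · exact congrFun hκ' i

/-- New exponent `κ₀ = 0`: threshold and multiplicity are those of the remaining variables.
[folklore] -/
theorem rlct_of_head_eq_zero (hk : κ 0 = 0) (hκ' : (fun i : Fin d => κ i.succ) ≠ 0) :
    rlct κ w = rlct (fun i : Fin d => κ i.succ) (fun i => w i.succ) ∧
    rlctMult κ w = rlctMult (fun i : Fin d => κ i.succ) (fun i => w i.succ) := by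
  have hκ : κ ≠ 0 := fun h => hκ' (by simp [h]; rfl)
  have h1 : rlct κ w = rlct (fun i : Fin d => κ i.succ) (fun i => w i.succ) := by
    refine rlct_eq_of hκ (fun j hj => ?_) ?_
    · revert hj
      refine Fin.cases (fun hj => absurd hk hj) (fun i hi => ?_) j
      exact rlct_le (κ := fun i : Fin d => κ i.succ) hi
    · obtain ⟨i, hi, hieq⟩ := exists_rlct_eq (w := fun i => w i.succ) hκ'
      exact ⟨i.succ, hi, hieq⟩
  refine ⟨h1, ?_⟩
  rw [rlctMult_eq_sum, rlctMult_eq_sum, Fin.sum_univ_succ, h1]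
  simp [hk]

/-- New exponent `κ₀ ≠ 0`, all other exponents zero: `(λ, θ) = (w₀/κ₀, 1)`. [folklore] -/
theorem rlct_of_tail_eq_zero (hk : κ 0 ≠ 0) (hκ' : (fun i : Fin d => κ i.succ) = 0) :
    rlct κ w = w 0 / κ 0 ∧ rlctMult κ w = 1 := by
  have hκ : κ ≠ 0 := fun h => hk (by simp [h])
  have htail : ∀ i : Fin d, κ i.succ = 0 := fun i => congrFun hκ' i
  have h1 : rlct κ w = w 0 / κ 0 := by
    refine rlct_eq_of hκ (fun j hj => ?_) ⟨0, hk, rfl⟩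
    revert hj
    refine Fin.cases (fun _ => le_rfl) (fun i hi => absurd (htail i) hi) j
  refine ⟨h1, ?_⟩
  rw [rlctMult_eq_sum, Fin.sum_univ_succ, h1]
  simp [hk, htail]

/-- New exponent `κ₀ ≠ 0` with ratio `r = w₀/κ₀` and remaining data with threshold `λ'` and
multiplicity `θ'`: `(λ, θ) = (r, 1)` if `r < λ'`, `(λ', θ')` if `λ' < r`, `(λ', θ' + 1)` if
`r = λ'` (Lin 2017, Prop. 2.1). [cite: Lin2017, Prop. 2.1] -/
theorem rlct_cons_of_lt (hk : κ 0 ≠ 0)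
    (hlt : w 0 / κ 0 < rlct (fun i : Fin d => κ i.succ) (fun i => w i.succ)) :
    rlct κ w = w 0 / κ 0 ∧ rlctMult κ w = 1 := by
  have hκ : κ ≠ 0 := fun h => hk (by simp [h])
  have h1 : rlct κ w = w 0 / κ 0 := by
    refine rlct_eq_of hκ (fun j hj => ?_) ⟨0, hk, rfl⟩
    revert hj
    refine Fin.cases (fun _ => le_rfl) (fun i hi => ?_) j
    exact (hlt.trans_le (rlct_le (κ := fun i : Fin d => κ i.succ) hi)).le
  refine ⟨h1, ?_⟩
  rw [rlctMult_eq_sum, Fin.sum_univ_succ, h1]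
  have h0 : ∀ i : Fin d, ¬ (κ i.succ ≠ 0 ∧ w i.succ / κ i.succ = w 0 / κ 0) := fun i h =>
    (hlt.trans_le (rlct_le (κ := fun i : Fin d => κ i.succ) h.1)).ne h.2.symm
  simp [hk, h0]

/-- Case `λ' < r`: `(λ, θ) = (λ', θ')`. [cite: Lin2017, Prop. 2.1] -/
theorem rlct_cons_of_gt (hk : κ 0 ≠ 0) (hκ' : (fun i : Fin d => κ i.succ) ≠ 0)
    (hgt : rlct (fun i : Fin d => κ i.succ) (fun i => w i.succ) < w 0 / κ 0) :
    rlct κ w = rlct (fun i : Fin d => κ i.succ) (fun i => w i.succ) ∧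
    rlctMult κ w = rlctMult (fun i : Fin d => κ i.succ) (fun i => w i.succ) := by
  have hκ : κ ≠ 0 := fun h => hk (by simp [h])
  have h1 : rlct κ w = rlct (fun i : Fin d => κ i.succ) (fun i => w i.succ) := by
    refine rlct_eq_of hκ (fun j hj => ?_) ?_
    · revert hj
      refine Fin.cases (fun _ => hgt.le) (fun i hi => ?_) j
      exact rlct_le (κ := fun i : Fin d => κ i.succ) hi
    · obtain ⟨i, hi, hieq⟩ := exists_rlct_eq (w := fun i => w i.succ) hκ'
      exact ⟨i.succ, hi, hieq⟩
  refine ⟨h1, ?_⟩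
  rw [rlctMult_eq_sum, rlctMult_eq_sum, Fin.sum_univ_succ, h1]
  simp [hk, hgt.ne']

/-- Case `r = λ'`: `(λ, θ) = (λ', θ' + 1)`. [cite: Lin2017, Prop. 2.1] -/
theorem rlct_cons_of_eq (hk : κ 0 ≠ 0) (hκ' : (fun i : Fin d => κ i.succ) ≠ 0)
    (heq : w 0 / κ 0 = rlct (fun i : Fin d => κ i.succ) (fun i => w i.succ)) :
    rlct κ w = rlct (fun i : Fin d => κ i.succ) (fun i => w i.succ) ∧
    rlctMult κ w = rlctMult (fun i : Fin d => κ i.succ) (fun i => w i.succ) + 1 := by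
  have hκ : κ ≠ 0 := fun h => hk (by simp [h])
  have h1 : rlct κ w = rlct (fun i : Fin d => κ i.succ) (fun i => w i.succ) := by
    refine rlct_eq_of hκ (fun j hj => ?_) ?_
    · revert hj
      refine Fin.cases (fun _ => heq.ge) (fun i hi => ?_) j
      exact rlct_le (κ := fun i : Fin d => κ i.succ) hi
    · obtain ⟨i, hi, hieq⟩ := exists_rlct_eq (w := fun i => w i.succ) hκ'
      exact ⟨i.succ, hi, hieq⟩
  refine ⟨h1, ?_⟩
  rw [rlctMult_eq_sum, rlctMult_eq_sum, Fin.sum_univ_succ, h1]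
  simp [hk, heq, add_comm]

end Cons

/-! ## The asymptotics of the tail profile -/

section Asymptotics

/-- **Power-log asymptotics of the weighted sublevel volumes of a monomial** (log-coordinates):
for `κ ≠ 0` and weights `w_j > 0` there is `C > 0` with
`tailProfile κ w s · e^{λ s} / s^{θ - 1} → C` as `s → ∞`, where `λ = rlct κ w = min_{κ_j ≠ 0} w_j/κ_j`
and `θ = rlctMult κ w` is the number of indices attaining the minimum; equivalently (`x = e^{-y}`,
`t = e^{-s}`) `vol_w {x ∈ (0,1]^d : x^κ ≤ t} ∼ C t^λ (log 1/t)^{θ-1}`. Proof by induction on the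
number of variables through the exponential-convolution step (AGV II §7.2, Thm. 7.1; Lin 2017,
Prop. 2.1). [cite: ArnoldGuseinzadeVarchenko2012, Part II §7.2 Thm. 7.1] [cite: Lin2017, Prop. 2.1] -/
theorem tendsto_tailProfile : ∀ (d : ℕ) (κ : Fin d → ℕ) (w : Fin d → ℝ), (∀ j, 0 < w j) → κ ≠ 0 →
    ∃ C : ℝ, 0 < C ∧ Tendsto (fun s => tailProfile κ w s * Real.exp (rlct κ w * s) /
      s ^ (rlctMult κ w - 1)) atTop (𝓝 C) := by
  intro d
  induction d with
  | zero =>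
      intro κ w _ hκ
      exact absurd (Subsingleton.elim κ 0) hκ
  | succ d ih =>
      intro κ w hw hκ
      -- the remaining variables
      set κ' : Fin d → ℕ := fun i => κ i.succ with hκ'def
      set w' : Fin d → ℝ := fun i => w i.succ with hw'def
      have hw' : ∀ i, 0 < w' i := fun i => hw _
      have hP' : 0 < ∏ i, 1 / w' i := Finset.prod_pos fun i _ => one_div_pos.2 (hw' i)
      have hrec : ∀ s, tailProfile κ w s = ∫ a in Ioi (0 : ℝ), Real.exp (-(w 0 * a)) *
          tailProfile κ' w' (s - κ 0 * a) := tailProfile_succ κ hw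
      have hmeas : Measurable (tailProfile κ' w') := (tailProfile_antitone κ' hw').measurable
      have hF0 : ∀ σ, 0 ≤ tailProfile κ' w' σ := tailProfile_nonneg κ'
      have hFP : ∀ σ, tailProfile κ' w' σ ≤ ∏ i, 1 / w' i := tailProfile_le κ' hw'
      have hFnp : ∀ σ, σ ≤ 0 → tailProfile κ' w' σ = ∏ i, 1 / w' i :=
        fun σ hσ => tailProfile_of_nonpos κ' hw' hσ
      by_cases hk : κ 0 = 0
      · -- the new variable does not occur in the monomial
        have hκ'ne : κ' ≠ 0 := fun h => hκ (eq_zero_of_head_tail κ hk h)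
        obtain ⟨C', hC', hT'⟩ := ih κ' w' hw' hκ'ne
        obtain ⟨hl, hm⟩ : rlct κ w = rlct κ' w' ∧ rlctMult κ w = rlctMult κ' w' :=
          rlct_of_head_eq_zero κ w hk hκ'ne
        refine ⟨C' * (1 / w 0), mul_pos hC' (one_div_pos.2 (hw 0)), ?_⟩
        rw [hl, hm]
        refine (hT'.mul_const (1 / w 0)).congr' (Eventually.of_forall fun s => ?_)
        dsimp only
        rw [hrec s]
        simp only [hk, CharP.cast_eq_zero, zero_mul, sub_zero, integral_mul_const,
          ExpTail.integral_exp_neg_mul_Ioi (hw 0)]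
        ring
      · have hkpos : (0 : ℝ) < κ 0 := by exact_mod_cast Nat.pos_of_ne_zero hk
        by_cases hκ'z : κ' = 0
        · -- all remaining exponents vanish: the profile of the rest is a step
          have hstep : ∀ σ, tailProfile κ' w' σ = if σ ≤ 0 then ∏ i, 1 / w' i else 0 :=
            tailProfile_of_eq_zero κ' hw' hκ'z
          have hint : Integrable (fun σ => Real.exp (w 0 / κ 0 * σ) * tailProfile κ' w' σ) := by
            refine ExpTail.integrable_exp_mul_of_decay (r := w 0 / κ 0) (lam := w 0 / κ 0 + 1)
              (K := 0) (σ₀ := 1) (m := 0) (div_pos (hw 0) hkpos) (by linarith) zero_le_one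
              hmeas hF0 hFP fun σ hσ => ?_
            rw [hstep σ, if_neg (by linarith)]
            simp
          obtain ⟨hM, hlim⟩ := ExpTail.tendsto_expConv_of_lt (ω := w 0) hkpos hF0 hFnp hP' hint
          obtain ⟨hl, hm⟩ : rlct κ w = w 0 / κ 0 ∧ rlctMult κ w = 1 :=
            rlct_of_tail_eq_zero κ w hk hκ'z
          refine ⟨(∫ σ, Real.exp (w 0 / κ 0 * σ) * tailProfile κ' w' σ) / κ 0,
            div_pos hM hkpos, ?_⟩
          rw [hl, hm]
          refine hlim.congr' (Eventually.of_forall fun s => ?_)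
          dsimp only
          rw [hrec s]
          simp
        · obtain ⟨C', hC', hT'⟩ := ih κ' w' hw' hκ'z
          have hθ' : 1 ≤ rlctMult κ' w' := rlctMult_pos hκ'z
          rcases lt_trichotomy (w 0 / κ 0) (rlct κ' w') with hlt | heq | hgt
          · -- `r < λ'`: the new variable dominates, `(λ, θ) = (r, 1)`
            obtain ⟨σ₀, hσ₀1, hσ₀⟩ := ExpTail.exists_ratio_near hT'
            have hint : Integrable (fun σ => Real.exp (w 0 / κ 0 * σ) * tailProfile κ' w' σ) :=
              ExpTail.integrable_exp_mul_of_decay (div_pos (hw 0) hkpos) hlt (by linarith)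
                hmeas hF0 hFP fun σ hσ => ExpTail.le_of_ratio_near hσ₀1 hσ₀ hσ
            obtain ⟨hM, hlim⟩ :=
              ExpTail.tendsto_expConv_of_lt (ω := w 0) hkpos hF0 hFnp hP' hint
            obtain ⟨hl, hm⟩ : rlct κ w = w 0 / κ 0 ∧ rlctMult κ w = 1 :=
              rlct_cons_of_lt κ w hk hlt
            refine ⟨(∫ σ, Real.exp (w 0 / κ 0 * σ) * tailProfile κ' w' σ) / κ 0,
              div_pos hM hkpos, ?_⟩
            rw [hl, hm]
            refine hlim.congr' (Eventually.of_forall fun s => ?_)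
            dsimp only
            rw [hrec s]
            simp
          · -- `r = λ'`: the multiplicity goes up, `(λ, θ) = (λ', θ' + 1)`
            have hT'' : Tendsto (fun σ => tailProfile κ' w' σ * Real.exp (w 0 / κ 0 * σ) /
                σ ^ (rlctMult κ' w' - 1)) atTop (𝓝 C') := by
              rw [heq]
              exact hT'
            have hlim := ExpTail.tendsto_expConv_of_eq (ω := w 0) hkpos (hw 0) hmeas hF0 hFP hT''
            rw [Nat.sub_add_cancel hθ'] at hlim
            obtain ⟨hl, hm⟩ : rlct κ w = rlct κ' w' ∧ rlctMult κ w = rlctMult κ' w' + 1 :=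
              rlct_cons_of_eq κ w hk hκ'z heq
            refine ⟨C' / (κ 0 * ((rlctMult κ' w' - 1 : ℕ) + 1)), by positivity, ?_⟩
            rw [hl, hm, Nat.add_sub_cancel, ← heq]
            refine hlim.congr' (Eventually.of_forall fun s => ?_)
            dsimp only
            rw [hrec s]
          · -- `λ' < r`: the old variables dominate, `(λ, θ) = (λ', θ')`
            have hlam : (κ 0 : ℝ) * rlct κ' w' < w 0 := by
              rwa [lt_div_iff₀ hkpos, mul_comm] at hgt
            have hlim := ExpTail.tendsto_expConv_of_gt (ω := w 0) hkpos (hw 0) hlam hmeas hF0 hFP hT'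
            obtain ⟨hl, hm⟩ : rlct κ w = rlct κ' w' ∧ rlctMult κ w = rlctMult κ' w' :=
              rlct_cons_of_gt κ w hk hκ'z hgt
            refine ⟨C' / (w 0 - κ 0 * rlct κ' w'), div_pos hC' (by linarith), ?_⟩
            rw [hl, hm]
            refine hlim.congr' (Eventually.of_forall fun s => ?_)
            dsimp only
            rw [hrec s]

/-- The tail profile in the form used downstream: explicit `λ > 0`, `θ ≥ 1`. [folklore] -/
theorem exists_tendsto_tailProfile (κ : Fin d → ℕ) (w : Fin d → ℝ) (hw : ∀ j, 0 < w j)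
    (hκ : κ ≠ 0) :
    ∃ C : ℝ, 0 < C ∧ 0 < rlct κ w ∧ 1 ≤ rlctMult κ w ∧
      Tendsto (fun s => tailProfile κ w s * Real.exp (rlct κ w * s) / s ^ (rlctMult κ w - 1))
        atTop (𝓝 C) := by
  obtain ⟨C, hC, h⟩ := tendsto_tailProfile d κ w hw hκ
  exact ⟨C, hC, rlct_pos hκ hw, rlctMult_pos hκ, h⟩

end Asymptotics

end Literature.Analysis.Asymptotics.MonomialPhase

end
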